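import Literature.Computability.Cryptography.TreeSigForgerB
import Literature.Computability.Cryptography.HashAndSignOTSSecurity
import Literature.Computability.Complexity.StackUnaryBits
import Literature.Computability.Complexity.TM2PassThrough
import Mathlib.Analysis.SpecificLimits.Normed
import Literature.Computability.Cryptography.PseudorandomFunctionsGeneralized
import HarnessLib

/-!
# The authentication-tree scheme, XIII: the one-time forger analysed; security and existence (Goldreich 2004, Prop. 6.4.15 / 6.4.17, Theorem 6.4.9)

Topic `Literature/Computability/Cryptography`. This file completes the security proof of the random-leaf
authentication-tree signature scheme `TreeSig.scheme P` (Goldreich's Construction 6.4.16 over a one-time signature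
scheme `S` and a pseudorandom function ensemble `F`; files `TreeSigSpec.lean` … `TreeSigForgerB.lean`) and draws the
existence theorem. Four parts:

* **Part A — what the one-time forger computes.** Semantics of the one-time forger `forgerB` of
  `TreeSigForgerB.lean` (proof of Prop. 6.4.15, Steps 1–4, in the lazy form of Prop. 6.4.17) in terms of the hybrid
  node interfaces of `TreeSigHybrid.lean` (`pkH`, `sgNW[L_t ↦ const v]`): the emulation computes the run and
  transcript of the tree forger against the hybrid signer (`resB_WB`, via the generic emulation lemma `sim_eq`), the
  decision stage computes `usedH` (`DB_iff`), the query stage the message `mH` the planted node must sign (`QB_eq`),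
  and the output stage the component of the forged signature at the planted level (`outB_WB`); `run_forgerB`.
* **Part B — its success probability.** In the one-time experiment of `S` (read through the exact one-query
  factorisation `cmaExp_toReal_eq_uniformAvg_of_le_one_exact`) the forger's success probability dominates, up to
  the factor `2^{-kS(n)}` lost in guessing the slot from `kS(n)` coins, the sum over the slots of the hybrid averages
  of `TreeSigHybrid.lean`: `∑_{t < NSlot} avg_r avg_w avg_c hybAvg n r w t c ≤ 2^{kS n} · oneTimeForgeProb S forgerB n`
  (`sum_hybAvg_le_forgerB`), with `2^{kS n} ≤ 2 · NSlot n + 1` (`two_pow_kS_le`).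
* **Part C — security.** For every PPT forger `𝒜`,
  `forgeProb (scheme P) 𝒜 n ≤ prfAdvantage F κ (·+1) R D n + TA(n)²/2ⁿ + (2 NSlot(n) + 1) · oneTimeForgeProb S B n`
  (`forgeProb_le`) with the PPT distinguisher `D` of `TreeSigDistinguisher.lean` and the PPT one-time forger `B`;
  hence (`isEUFCMA`) the tree scheme is EUF-CMA secure whenever `F` is a PRF at the lengths used, `S` is one-time
  secure with signatures of bounded length whose signer reads boundedly many coins, and the bookkeeping hypotheses
  `WF` hold.
* **Part D — existence** (the existence form of Theorem 6.4.9 via Prop. 6.4.17 and Construction 6.4.16): if a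
  one-time secure signature scheme (with the stated bookkeeping) exists and pseudorandom functions exist, then
  EUF-CMA secure signature schemes exist (`secureSignaturesExist_of_isOneTimeSecure_of_PRFExist`); the PRF at the
  lengths the tree needs (`n + 1`-bit inputs, `pG(n) + CS(n)`-bit outputs) comes from a length-preserving one by
  `PseudorandomFunctionsGeneralized.lean` (Goldreich 2001, §3.6.4).

All proved; no named facts.

## References

* O. Goldreich, *Foundations of Cryptography II*, CUP 2004, §6.4.2: proof of Prop. 6.4.15, Steps 1–4 ("with
  probability at least `1/((2n+1)·t)` … `A` succeeds"); Construction 6.4.16, Prop. 6.4.17; Theorem 6.4.9 ("secure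
  (general) signature schemes exist if secure one-time signature schemes … exist").
* O. Goldreich, *Foundations of Cryptography I*, CUP 2001, §3.6.4 (generalized pseudorandom functions).
* O. Goldreich, S. Goldwasser, S. Micali, *How to construct random functions*, J. ACM 33 (1986).
* R. C. Merkle, *A certified digital signature*, CRYPTO '89, LNCS 435 (1990).
-/

/-! ## Part A. The one-time forger — what it computes

Topic `Literature/Computability/Cryptography`; semantics of the one-time forger `forgerB` of `TreeSigForgerB.lean`
(Goldreich 2004, proof of Prop. 6.4.15 / 6.4.17). In terms of the hybrid node interfaces of `TreeSigHybrid.lean`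
(`pkH`, `sgNW[L_t ↦ const v]`): the emulation computes the run and transcript of the tree forger against the hybrid
signer (`resB_WB`, via the generic emulation lemma `sim_eq`), the decision stage computes `usedH` (`DB_eq`), the query
stage the message `mH` the planted node must sign (`QB_eq`), and the output stage the component of the forged
signature at the planted level (`outB_WB`).
-/

namespace Literature.Computability.Cryptography

open _root_.Computability Complexity Complexity.Brick Polynomial
open Complexity.Plumb Complexity.OracleCompose Complexity.HashBricks Complexity.OracleAlg

namespace TreeSig

variable {P : Spec} {𝒜 : OracleAdversary (List Bool × List Bool)}

/-! ### The generic emulation lemma -/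

/-- **What the emulation computes, generically.** For an input presentation `pre W = ⟨xA n pk, r_A⟩` and an answering
rule that answers the `i`-th tagged query `α` by `⟨α, O i α⟩` for `i < TA(n)` with short answers, the emulation
`simFn (EM 𝒜) pre ans` with the standard caps computes `⟨w_out, listBool records⟩` of the indexed attack of `𝒜` against
`O`. [Goldreich 2004, proofs of Prop. 6.4.15 / 6.4.17 (the emulated attack)] [folklore] -/
theorem sim_eq {B : Bounds} (hB : B.OK P 𝒜) {n : ℕ} (pre ans : List Bool → List Bool) (W : List Bool) (O : ℕ → List Bool → List Bool)
    (pk rAv : List Bool) (hpk : pk.length ≤ P.PK.eval n) (hrAv : rAv.length ≤ cA P 𝒜 n) (hnW : n ≤ W.length)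
    (hpre : pre W = boolPair (xA P n pk) rAv)
    (hans : ∀ i < TA P 𝒜 n, ∀ α, ans (boolPair W (boolPair (unaryEncodeNat i) α)) = boolPair α (O i α))
    (hlen : ∀ i < TA P 𝒜 n, ∀ α, (O i α).length ≤ B.Lsig.eval n) :
    simFn (EM 𝒜) pre ans (B.cOf P 𝒜) (Bounds.ROf P 𝒜) W =
      boolPair (((𝒜.alg.runIdx O (TA P 𝒜 n) (boolPair (xA P n pk) rAv)).map ePair).getD [true])
        ((encodingList Bool).listBool.encode (recordsOf O 0 (𝒜.alg.queriesIdx O (TA P 𝒜 n) (boolPair (xA P n pk) rAv)))) := by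
  set Ow : Oracle := fun q' => ans (boolPair W q') with hOw
  set x₀ := boolPair (xA P n pk) rAv with hx₀
  have hOw_apply : ∀ i < TA P 𝒜 n, ∀ α, Ow (boolPair (unaryEncodeNat i) α) = boolPair α (O i α) := fun i hi α => hans i hi α
  have hagree : ∀ i < TA P 𝒜 n, ∀ α, idxOracle (sndF ∘ Ow) i α = O i α := by
    intro i hi α
    rw [idxOracle, Function.comp_apply, hOw_apply i hi, sndF_boolPair]
  have hTA : 𝒜.fuel.eval (xA P n pk).length = TA P 𝒜 n := by rw [length_xA P hpk, TA]
  have hR : 𝒜.fuel.eval (xA P n pk).length < (Bounds.ROf P 𝒜).eval W.length := by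
    rw [hTA, Bounds.ROf, eval_add, eval_one]
    have h1 := TM2Iter.eval_mono (TAPoly P 𝒜) hnW
    rw [← TA_eq] at h1; omega
  have hrun := run_simMFst 𝒜.alg ePair 𝒜.fuel [true] sndF hOut Ow (xA P n pk) rAv hR
  rw [hTA, ← hx₀] at hrun
  have hqs : 𝒜.alg.queriesIdx (idxOracle (sndF ∘ Ow)) (TA P 𝒜 n) x₀ = 𝒜.alg.queriesIdx O (TA P 𝒜 n) x₀ := queriesIdx_congr_lt _ _ _ hagree
  have hro : 𝒜.alg.runIdx (idxOracle (sndF ∘ Ow)) (TA P 𝒜 n) x₀ = 𝒜.alg.runIdx O (TA P 𝒜 n) x₀ := runIdx_congr_lt _ _ _ hagree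
  rw [hqs, hro] at hrun
  have hlenqs : (𝒜.alg.queriesIdx O (TA P 𝒜 n) x₀).length ≤ TA P 𝒜 n := OracleAlg.length_queriesIdx_le _ _ _ _
  have hx₀len : x₀.length = 2 * ℓx P n + 2 + rAv.length := by rw [hx₀, length_boolPair, length_xA P hpk]
  have hqlen : ∀ q ∈ (EM 𝒜).queries Ow ((Bounds.ROf P 𝒜).eval W.length) (pre W), q.length ≤ (B.cOf P 𝒜).eval W.length := by
    intro q hq
    rw [hpre, EM, hrun.2] at hq
    obtain ⟨j, hj, rfl⟩ := List.getElem_of_mem hq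
    rw [getElem_tagFrom, Nat.zero_add, length_boolPair, Complexity.unaryEncodeNat_eq_replicate, List.length_replicate]
    rw [length_tagFrom] at hj
    have hjT : j < TA P 𝒜 n := hj.trans_le hlenqs
    have hq' : (𝒜.alg.queriesIdx O (TA P 𝒜 n) x₀)[j] ∈ 𝒜.alg.queriesIdxAux O x₀ (TA P 𝒜 n) [] := List.getElem_mem _
    have hbound := length_le_of_mem_queriesIdxAux 𝒜.alg hB.hRA O (La := B.Lsig.eval n) (T := TA P 𝒜 n)
      (fun i hi q => hlen i hi q) x₀ (TA P 𝒜 n) [] (by simp) (by simp) _ hq'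
    have hmono : (B.cOf P 𝒜).eval n ≤ (B.cOf P 𝒜).eval W.length := TM2Iter.eval_mono _ hnW
    refine le_trans ?_ hmono
    rw [Bounds.cOf, eval_add, eval_add, eval_mul, eval_ofNat, ← TA_eq, Bounds.Lq, eval_comp]
    have hin : 2 * x₀.length + 2 + (2 * TA P 𝒜 n + 2 + TA P 𝒜 n * (2 * B.Lsig.eval n + 2)) ≤ (B.Lstep P 𝒜).eval n := by
      simp only [Bounds.Lstep, eval_add, eval_mul, eval_ofNat, ← ℓx_eq, Bounds.Lans, ← TA_eq, ← cA_eq]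
      rw [hx₀len]
      omega
    have := TM2Iter.eval_mono B.RA hin
    omega
  have hsim : simFn (EM 𝒜) pre ans (B.cOf P 𝒜) (Bounds.ROf P 𝒜) W = hOut (boolPair x₀ (boolPair
      ((encodingList Bool).listBool.encode (answersOf Ow (𝒜.alg.queriesIdx O (TA P 𝒜 n) x₀)))
      (((𝒜.alg.runIdx O (TA P 𝒜 n) x₀).map ePair).getD [true]))) := by
    refine simFn_eq_of_run ?_ hqlen
    rw [hpre, EM]
    exact hrun.1
  rw [hsim, hOut_apply, answersOf, map_tagFrom_eq_recordsOf Ow O 0 _ fun j hj q => by rw [Nat.zero_add]; exact hOw_apply j (hj.trans_le hlenqs) q]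

/-! ### The hybrid oracle of the emulation and its bounds -/

section Hyb

variable (P 𝒜)

/-- The hybrid oracle the emulation runs against: the signer over `pkH` with the planted node answering `v`. [folklore] -/
noncomputable def OvB (n : ℕ) (rB : List Bool) (c v : List Bool) : ℕ → List Bool → List Bool :=
  OFunI n (pkH P 𝒜 n (rOfB P 𝒜 n rB) (wOfB P 𝒜 n rB) (tOfB P 𝒜 n rB) c)
    (Function.update (sgNW P 𝒜 n (rOfB P 𝒜 n rB) (wOfB P 𝒜 n rB)) (Lslot P 𝒜 n (rOfB P 𝒜 n rB) (tOfB P 𝒜 n rB)) fun _ => v)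
    (ρD P 𝒜 n (rOfB P 𝒜 n rB))

variable {P 𝒜}

/-- A node-interface signature is short when the keys and signers are short on labels no longer than the leaf. [folklore] -/
theorem length_sigGI_le_of_path (B : Bounds) {pkN : List Bool → List Bool} {sgN : List Bool → List Bool → List Bool} {n : ℕ}
    (hpk : ∀ L, (pkN L).length ≤ B.A.eval n) (hsg : ∀ L m, L.length ≤ n → (sgN L m).length ≤ B.PS.eval n) (α : List Bool) {σ : List Bool}
    (hσ : σ.length ≤ n) : (sigGI pkN sgN α σ).length ≤ B.Lsig.eval n := by
  classical
  set sgN' : List Bool → List Bool → List Bool := fun L m => if L.length ≤ n then sgN L m else [] with hsgN'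
  have heq : sigGI pkN sgN α σ = sigGI pkN sgN' α σ := by
    have hsg' : ∀ j ≤ σ.length, ∀ m, sgN ([] ++ σ.take j) m = sgN' ([] ++ σ.take j) m := by
      intro j hj m
      rw [hsgN', List.nil_append]
      dsimp only
      rw [if_pos ((List.length_take_le' j σ).trans hσ)]
    rw [sigGI, sigGI, chainG, chainG, chainItems_congr (pkN' := pkN) (sgN' := sgN') [] σ (fun L _ => rfl) hsg']
    have := hsg' σ.length le_rfl α
    simp only [List.nil_append, List.take_length] at this ⊢
    rw [this]
  rw [heq]
  refine length_sigGI_le B hpk (fun L m => ?_) α hσ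
  rw [hsgN']
  dsimp only
  split_ifs with hL
  · exact hsg L m hL
  · simp

variable {n : ℕ} {c rB v : List Bool}

/-- The hybrid keys are short. [folklore] -/
theorem length_pkH_le {B : Bounds} (hB : B.OK P 𝒜) (hc : c.length = P.pG.eval n) (r w : List Bool) (t : ℕ) (L : List Bool) :
    (pkH P 𝒜 n r w t c L).length ≤ B.A.eval n := by
  rw [pkH]
  by_cases hL : L = Lslot P 𝒜 n r t
  · subst hL
    rw [Function.update_self]
    have : (P.S.keyGen.run n c).1 = pkOf P n c := by rw [pkOf, keyOf, List.take_of_length_le hc.le]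
    rw [this]; exact hB.hA n c
  · rw [Function.update_of_ne hL]; exact hB.hA n _

/-- The blocks of short labels are long enough. [folklore] -/
theorem pG_le_length_TabW (r w : List Bool) {L : List Bool} (hL : L.length ≤ n) : P.pG.eval n ≤ (TabW P 𝒜 n r w L).length := by
  rw [TabW, tspec_key_eq, dif_pos (length_code hL)]
  dsimp only
  rw [length_fitLen]
  exact pG_le_R n

/-- The hybrid signers are short on short labels. [folklore] -/
theorem length_sgHv_le (hW : P.WF) {B : Bounds} (hB : B.OK P 𝒜) (hv : v.length ≤ B.PS.eval n) (r w : List Bool) (t : ℕ) {L : List Bool}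
    (hL : L.length ≤ n) (m : List Bool) :
    (Function.update (sgNW P 𝒜 n r w) (Lslot P 𝒜 n r t) (fun _ => v) L m).length ≤ B.PS.eval n := by
  by_cases hLt : L = Lslot P 𝒜 n r t
  · subst hLt; rw [Function.update_self]; exact hv
  · rw [Function.update_of_ne hLt, sgNW]
    exact length_signOf_le hW hB (pG_le_length_TabW r w hL) m

/-- **The hybrid oracle is short below the budget.** [folklore] -/
theorem length_OvB_le (hW : P.WF) {B : Bounds} (hB : B.OK P 𝒜) (hc : c.length = P.pG.eval n) (hv : v.length ≤ B.PS.eval n)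
    (hρ : TA P 𝒜 n * n ≤ (ρD P 𝒜 n (rOfB P 𝒜 n rB)).length) {i : ℕ} (hi : i < TA P 𝒜 n) (α : List Bool) :
    (OvB P 𝒜 n rB c v i α).length ≤ B.Lsig.eval n := by
  have hσ : (Yao.blk n i (ρD P 𝒜 n (rOfB P 𝒜 n rB))).length = n := Yao.length_blk_of_le (by nlinarith)
  exact length_sigGI_le_of_path B (fun L => length_pkH_le hB hc _ _ _ L) (fun L m hL => length_sgHv_le hW hB hv _ _ _ hL m) α hσ.le

/-- **The pieces of the chain loop of the emulation are shorter than the clip.** [folklore] -/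
theorem pieceZ_hyb_le (hW : P.WF) {B : Bounds} (hB : B.OK P 𝒜) (hc : c.length = P.pG.eval n) (hv : v.length ≤ B.PS.eval n)
    {σ : List Bool} (hσ : σ.length = n) (α cnt σ' pre acc : List Bool) (_hne : σ' ≠ []) (hpre : pre ++ σ' = σ) :
    (pieceZ (pkFB P 𝒜) (sgFB P 𝒜) (boolPair (boolPair (envB n (P.S.keyGen.run n c).1 rB v) α) (boolPair cnt (boolPair σ' (boolPair pre acc))))).length ≤
      B.PcOf.eval (boolPair (envB n (P.S.keyGen.run n c).1 rB v) α).length := by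
  have hmono : B.PcOf.eval n ≤ B.PcOf.eval (boolPair (envB n (P.S.keyGen.run n c).1 rB v) α).length :=
    TM2Iter.eval_mono _ (by simp only [envB, length_boolPair, ones, List.length_replicate]; omega)
  refine le_trans ?_ hmono
  have hpreL : pre.length ≤ n := by rw [← hσ, ← hpre]; simp
  rw [pieceZ_apply, fstF_boolPair]
  simp only [encList_cons, encList_nil, length_boolPair, List.length_nil, pkFB_env, sgFB_env]
  have h0 := length_pkH_le hB hc (rOfB P 𝒜 n rB) (wOfB P 𝒜 n rB) (tOfB P 𝒜 n rB) (pre ++ [false])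
  have h1 := length_pkH_le hB hc (rOfB P 𝒜 n rB) (wOfB P 𝒜 n rB) (tOfB P 𝒜 n rB) (pre ++ [true])
  have hs := length_sgHv_le hW hB hv (rOfB P 𝒜 n rB) (wOfB P 𝒜 n rB) (tOfB P 𝒜 n rB) hpreL
    (boolPair (pkH P 𝒜 n (rOfB P 𝒜 n rB) (wOfB P 𝒜 n rB) (tOfB P 𝒜 n rB) c (pre ++ [false])) (pkH P 𝒜 n (rOfB P 𝒜 n rB) (wOfB P 𝒜 n rB) (tOfB P 𝒜 n rB) c (pre ++ [true])))
  simp only [Bounds.PcOf, eval_add, eval_mul, eval_ofNat]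
  omega

/-- **The answering rule of the emulation IS the hybrid oracle** (with the echoed query) below the budget. [folklore] -/
theorem ansB_eq_OvB (hW : P.WF) {B : Bounds} (hB : B.OK P 𝒜) (hc : c.length = P.pG.eval n) (hv : v.length ≤ B.PS.eval n)
    (hρ : TA P 𝒜 n * n ≤ (ρD P 𝒜 n (rOfB P 𝒜 n rB)).length) {i : ℕ} (hi : i < TA P 𝒜 n) (α : List Bool) :
    ansB P 𝒜 B.PcOf (boolPair (WB n (P.S.keyGen.run n c).1 rB v) (boolPair (unaryEncodeNat i) α)) = boolPair α (OvB P 𝒜 n rB c v i α) := by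
  have hσ : (Yao.blk n i (ρD P 𝒜 n (rOfB P 𝒜 n rB))).length = n := Yao.length_blk_of_le (by nlinarith)
  rw [OvB]
  exact ansB_WB n rB v i α (by rw [hσ]; simp only [envB, length_boolPair, ones, List.length_replicate]; omega)
    fun cnt σ' pre acc hne hpre => pieceZ_hyb_le hW hB hc hv hσ α cnt σ' pre acc hne hpre

/-- **What the emulation of the one-time forger computes**: `⟨w_out, listBool records⟩` of the indexed attack of `𝒜`
against the hybrid oracle. [Goldreich 2004, proof of Prop. 6.4.15, Steps 2–3] [folklore] -/
theorem resB_WB (hW : P.WF) {B : Bounds} (hB : B.OK P 𝒜) (hc : c.length = P.pG.eval n) (hv : v.length ≤ B.PS.eval n)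
    (hrB : (cDPoly P 𝒜).eval n ≤ rB.length) :
    resB P 𝒜 B.PcOf (B.cOf P 𝒜) (Bounds.ROf P 𝒜) (WB n (P.S.keyGen.run n c).1 rB v) =
      boolPair (((𝒜.alg.runIdx (OvB P 𝒜 n rB c v) (TA P 𝒜 n)
          (xH P 𝒜 n (rOfB P 𝒜 n rB) (pkH P 𝒜 n (rOfB P 𝒜 n rB) (wOfB P 𝒜 n rB) (tOfB P 𝒜 n rB) c))).map ePair).getD [true])
        ((encodingList Bool).listBool.encode (recordsOf (OvB P 𝒜 n rB c v) 0 (𝒜.alg.queriesIdx (OvB P 𝒜 n rB c v) (TA P 𝒜 n)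
          (xH P 𝒜 n (rOfB P 𝒜 n rB) (pkH P 𝒜 n (rOfB P 𝒜 n rB) (wOfB P 𝒜 n rB) (tOfB P 𝒜 n rB) c))))) := by
  have hr : (rOfB P 𝒜 n rB).length = (cDPoly P 𝒜).eval n := by rw [rOfB, List.length_take, min_eq_left hrB]
  have hρ : TA P 𝒜 n * n ≤ (ρD P 𝒜 n (rOfB P 𝒜 n rB)).length := by rw [ρD, List.length_drop, hr, cDPoly_eval]; omega
  rw [resB, xH]
  refine sim_eq hB _ _ _ _ _ _ ?_ ?_ ?_ (preB_WB n rB v) (fun i hi α => ansB_eq_OvB hW hB hc hv hρ hi α) fun i hi α => length_OvB_le hW hB hc hv hρ hi α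
  · have : pkH P 𝒜 n (rOfB P 𝒜 n rB) (wOfB P 𝒜 n rB) (tOfB P 𝒜 n rB) c [] = (P.S.keyGen.run n c).1 ∨
        pkH P 𝒜 n (rOfB P 𝒜 n rB) (wOfB P 𝒜 n rB) (tOfB P 𝒜 n rB) c [] = pkOf P n (TabW P 𝒜 n (rOfB P 𝒜 n rB) (wOfB P 𝒜 n rB) []) := by
      rw [pkH]
      by_cases h0 : ([] : List Bool) = Lslot P 𝒜 n (rOfB P 𝒜 n rB) (tOfB P 𝒜 n rB)
      · left; rw [h0, Function.update_self]
      · right; rw [Function.update_of_ne h0, pkNW]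
    rcases this with h | h
    · rw [h]; exact hW.hPK n c hc
    · rw [h]
      refine hW.hPK n _ ?_
      rw [List.length_take, min_eq_left (pG_le_length_TabW _ _ (by simp))]
  · rw [rA, List.length_take]; exact min_le_left _ _
  · simp only [WB, length_boolPair, Complexity.unaryEncodeNat_eq_replicate, List.length_replicate]; omega

end Hyb

/-! ### What the stages compute -/

section StagesSem

variable {n : ℕ} {c rB v : List Bool}

/-- The records have the length of the transcript. [folklore] -/
theorem length_recordsOf (O : ℕ → List Bool → List Bool) (i : ℕ) (qs : List (List Bool)) : (recordsOf O i qs).length = qs.length := by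
  rw [← List.length_map (f := fstF), map_fstF_recordsOf]

/-- `nthF j z = fstF (sndFʲ z)`. [folklore] -/
theorem nthF_eq_fstF_iterate : ∀ (j : ℕ) (z : List Bool), nthF j z = fstF (sndF^[j] z)
  | 0, _ => rfl
  | j + 1, z => by rw [nthF, Function.comp_apply, nthF_eq_fstF_iterate j, Function.iterate_succ_apply]

/-- `dropItems l = sndF^{3l}`. [folklore] -/
theorem dropItems_eq_iterate : ∀ (l : ℕ) (z : List Bool), dropItems l z = sndF^[3 * l] z
  | 0, _ => rfl
  | l + 1, z => by
    rw [dropItems_succ, dropItems_eq_iterate l, show 3 * (l + 1) = 3 + 3 * l by ring, Function.iterate_add_apply]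
    rfl

/-- The records over the queries, indexed. [folklore] -/
theorem getD_recordsOf (O : ℕ → List Bool → List Bool) : ∀ (i j : ℕ) (qs : List (List Bool)),
    fstF ((recordsOf O i qs).getD j []) = qs.getD j []
  | _, j, [] => by cases j <;> simp [recordsOf, fstF, boolUnpair]
  | i, 0, q :: qs => by simp [recordsOf]
  | i, j + 1, q :: qs => by rw [recordsOf, List.getD_cons_succ, List.getD_cons_succ]; exact getD_recordsOf O (i + 1) j qs

variable (hW : P.WF) {B : Bounds} (hB : B.OK P 𝒜) (hc : c.length = P.pG.eval n) (hv : v.length ≤ B.PS.eval n) (hrB : (cDPoly P 𝒜).eval n ≤ rB.length)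
include hW hB hc hv hrB

/-- The decision stage compares the first use with the number of records. [folklore] -/
theorem usedF_WB : usedF P 𝒜 B.PcOf (B.cOf P 𝒜) (Bounds.ROf P 𝒜) (WB n (P.S.keyGen.run n c).1 rB v) =
    [decide (firstIdx (Lslot P 𝒜 n (rOfB P 𝒜 n rB) (tOfB P 𝒜 n rB)) (prefsOf n (TA P 𝒜 n) (ρD P 𝒜 n (rOfB P 𝒜 n rB)) (Lslot P 𝒜 n (rOfB P 𝒜 n rB) (tOfB P 𝒜 n rB))) + 1 ≤
      (𝒜.alg.queriesIdx (OvB P 𝒜 n rB c v) (TA P 𝒜 n) (xH P 𝒜 n (rOfB P 𝒜 n rB) (pkH P 𝒜 n (rOfB P 𝒜 n rB) (wOfB P 𝒜 n rB) (tOfB P 𝒜 n rB) c))).length)] := by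
  rw [usedF, Function.comp_apply, fanoutFn_apply, Function.comp_apply, Function.comp_apply, resB_WB hW hB hc hv hrB, sndF_boolPair,
    PrefixPostPoly.listBool_encode_eq, fstF_boolPair, Function.comp_apply, bfuF_WB, lenLeFn_boolPair, eval_X, Complexity.unaryEncodeNat_eq_replicate,
    List.length_replicate, List.length_cons, ones, List.length_replicate, length_recordsOf]

/-- **The decision stage computes `Used`** (against the planted answer `v`). [Goldreich 2004, proof of Prop. 6.4.15, Step 3] [folklore] -/
theorem usedF_WB_iff : usedF P 𝒜 B.PcOf (B.cOf P 𝒜) (Bounds.ROf P 𝒜) (WB n (P.S.keyGen.run n c).1 rB v) = [true] ↔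
    Used (P := P) (𝒜 := 𝒜) n (pkH P 𝒜 n (rOfB P 𝒜 n rB) (wOfB P 𝒜 n rB) (tOfB P 𝒜 n rB) c)
      (Function.update (sgNW P 𝒜 n (rOfB P 𝒜 n rB) (wOfB P 𝒜 n rB)) (Lslot P 𝒜 n (rOfB P 𝒜 n rB) (tOfB P 𝒜 n rB)) fun _ => v)
      (ρD P 𝒜 n (rOfB P 𝒜 n rB)) (Lslot P 𝒜 n (rOfB P 𝒜 n rB) (tOfB P 𝒜 n rB))
      (xH P 𝒜 n (rOfB P 𝒜 n rB) (pkH P 𝒜 n (rOfB P 𝒜 n rB) (wOfB P 𝒜 n rB) (tOfB P 𝒜 n rB) c)) := by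
  rw [usedF_WB hW hB hc hv hrB]
  unfold Used
  rw [firstUse_eq_firstIdx, OvB]
  simp

/-- **The query stage computes `mH`** when run without the answer. [Goldreich 2004, proof of Prop. 6.4.15, Step 3] [folklore] -/
theorem mstarF_WB_nil (hv' : v = []) : mstarF P 𝒜 B.PcOf (B.cOf P 𝒜) (Bounds.ROf P 𝒜) (WB n (P.S.keyGen.run n c).1 rB v) =
    mH P 𝒜 n (rOfB P 𝒜 n rB) (wOfB P 𝒜 n rB) (tOfB P 𝒜 n rB) c := by
  subst hv'
  rw [mstarF, iteFn_apply (binternalF_WB n _ rB []), mH, mStar]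
  by_cases hL : (Lslot P 𝒜 n (rOfB P 𝒜 n rB) (tOfB P 𝒜 n rB)).length < n
  · rw [decide_eq_true hL, if_pos rfl, if_pos hL, bpairF_WB]
  · rw [decide_eq_false hL, if_neg hL]
    simp only [Bool.false_eq_true, if_false]
    rw [bleafMsgF, Function.comp_apply, Function.comp_apply, fanoutFn_apply, bfuF_WB, Function.comp_apply, Function.comp_apply,
      resB_WB hW hB hc hv hrB, sndF_boolPair, PrefixPostPoly.listBool_encode_eq, sndF_boolPair, nthItemFn_boolPair, ones, List.length_replicate,
      ← firstUse_eq_firstIdx, sndF_iterate_encList, mStarLeaf]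
    have hhead : ∀ l : List (List Bool), fstF (encList l) = l.headD [] := by
      intro l; cases l with
      | nil => simp [fstF, boolUnpair, encList_nil]
      | cons a l => rw [encList_cons, fstF_boolPair]; rfl
    rw [hhead, List.headD_eq_head?_getD, List.head?_drop, ← List.getD_eq_getElem?_getD, getD_recordsOf, OvB, xH]

/-- **The output stage computes the component of the forged signature at the planted level.** [Goldreich 2004, proof of
Prop. 6.4.15, Step 4] [folklore] -/
theorem outB_WB : outB P 𝒜 B.PcOf (B.cOf P 𝒜) (Bounds.ROf P 𝒜) (WB n (P.S.keyGen.run n c).1 rB v) =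
    (let wout := ((𝒜.alg.runIdx (OvB P 𝒜 n rB c v) (TA P 𝒜 n)
        (xH P 𝒜 n (rOfB P 𝒜 n rB) (pkH P 𝒜 n (rOfB P 𝒜 n rB) (wOfB P 𝒜 n rB) (tOfB P 𝒜 n rB) c))).map ePair).getD [true]
     boolPair (compAt n (fstF wout) (sndF (sndF wout)) (Lslot P 𝒜 n (rOfB P 𝒜 n rB) (tOfB P 𝒜 n rB)).length).1
       (compAt n (fstF wout) (sndF (sndF wout)) (Lslot P 𝒜 n (rOfB P 𝒜 n rB) (tOfB P 𝒜 n rB)).length).2) := by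
  set L := Lslot P 𝒜 n (rOfB P 𝒜 n rB) (tOfB P 𝒜 n rB) with hL
  have hitem : ∀ k, bitemF P 𝒜 k B.PcOf (B.cOf P 𝒜) (Bounds.ROf P 𝒜) (WB n (P.S.keyGen.run n c).1 rB v) =
      nthF k (dropItems L.length (sndF (sndF (((𝒜.alg.runIdx (OvB P 𝒜 n rB c v) (TA P 𝒜 n)
        (xH P 𝒜 n (rOfB P 𝒜 n rB) (pkH P 𝒜 n (rOfB P 𝒜 n rB) (wOfB P 𝒜 n rB) (tOfB P 𝒜 n rB) c))).map ePair).getD [true])))) := by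
    intro k
    rw [bitemF, Function.comp_apply, fanoutFn_apply, Function.comp_apply, b3F_WB, bitsF, Function.comp_apply, Function.comp_apply,
      Function.comp_apply, resB_WB hW hB hc hv hrB, fstF_boolPair, nthItemFn_boolPair, nthF_eq_fstF_iterate, dropItems_eq_iterate,
      ← Function.iterate_add_apply]
    congr 2
    simp only [List.length_append, List.length_replicate, ← hL]; ring
  have hα : bαF P 𝒜 B.PcOf (B.cOf P 𝒜) (Bounds.ROf P 𝒜) (WB n (P.S.keyGen.run n c).1 rB v) =
      fstF (((𝒜.alg.runIdx (OvB P 𝒜 n rB c v) (TA P 𝒜 n)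
        (xH P 𝒜 n (rOfB P 𝒜 n rB) (pkH P 𝒜 n (rOfB P 𝒜 n rB) (wOfB P 𝒜 n rB) (tOfB P 𝒜 n rB) c))).map ePair).getD [true]) := by
    rw [bαF, Function.comp_apply, Function.comp_apply, resB_WB hW hB hc hv hrB, fstF_boolPair]
  rw [outB, iteFn_apply (binternalF_WB n _ rB v)]
  dsimp only
  rw [compAt]
  by_cases hlt : L.length < n
  · rw [decide_eq_true hlt, if_pos rfl, if_pos hlt]
    simp only [fanoutFn_apply, hitem]
  · rw [decide_eq_false hlt, if_neg hlt]
    simp only [Bool.false_eq_true, if_false, fanoutFn_apply, hitem, hα]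

end StagesSem

/-! ### The one-time forger in the one-time experiment -/

section Experiment

variable {n : ℕ} {c rB : List Bool}

/-- The machine input of the one-time forger. [folklore] -/
def xrB (n : ℕ) (pk rB : List Bool) : List Bool := boolPair (boolPair (unaryEncodeNat n) pk) rB

/-- `w0F_xrB` (bookkeeping). [folklore] -/
theorem w0F_xrB (pk : List Bool) : w0F (xrB n pk rB) = WB n pk rB [] := by rw [w0F_apply]; rfl

variable (hW : P.WF) {B : Bounds} (hB : B.OK P 𝒜) (hc : c.length = P.pG.eval n) (hrB : (cDPoly P 𝒜).eval n ≤ rB.length)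
include hW hB hc hrB

/-- **The decision stage computes `usedH`.** [folklore] -/
theorem DB_iff : DB P 𝒜 B.PcOf (B.cOf P 𝒜) (Bounds.ROf P 𝒜) (xrB n (P.S.keyGen.run n c).1 rB) = [true] ↔
    usedH P 𝒜 n (rOfB P 𝒜 n rB) (wOfB P 𝒜 n rB) (tOfB P 𝒜 n rB) c := by
  rw [DB, Function.comp_apply, w0F_xrB, usedF_WB_iff hW hB hc (v := []) (by simp) hrB, usedH]

/-- **The query stage computes `mH`.** [folklore] -/
theorem QB_eq : QB P 𝒜 B.PcOf (B.cOf P 𝒜) (Bounds.ROf P 𝒜) (xrB n (P.S.keyGen.run n c).1 rB) = mH P 𝒜 n (rOfB P 𝒜 n rB) (wOfB P 𝒜 n rB) (tOfB P 𝒜 n rB) c := by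
  rw [QB, Function.comp_apply, w0F_xrB, mstarF_WB_nil hW hB hc (v := []) (by simp) hrB rfl]

/-- The output pair of the one-time forger with planted answer `v`. [folklore] -/
noncomputable def outPair (n : ℕ) (rB c v : List Bool) : List Bool × List Bool :=
  let wout := ((𝒜.alg.runIdx (OvB P 𝒜 n rB c v) (TA P 𝒜 n)
      (xH P 𝒜 n (rOfB P 𝒜 n rB) (pkH P 𝒜 n (rOfB P 𝒜 n rB) (wOfB P 𝒜 n rB) (tOfB P 𝒜 n rB) c))).map ePair).getD [true]
  compAt n (fstF wout) (sndF (sndF wout)) (Lslot P 𝒜 n (rOfB P 𝒜 n rB) (tOfB P 𝒜 n rB)).length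

omit hW hB hc hrB in
/-- `outB_WB'` (bookkeeping). [folklore] -/
theorem outB_WB' {v : List Bool} (hv : v.length ≤ B.PS.eval n) (hW : P.WF) (hB : B.OK P 𝒜) (hc : c.length = P.pG.eval n) (hrB : (cDPoly P 𝒜).eval n ≤ rB.length) :
    outB P 𝒜 B.PcOf (B.cOf P 𝒜) (Bounds.ROf P 𝒜) (WB n (P.S.keyGen.run n c).1 rB v) =
      boolPair (outPair (P := P) (𝒜 := 𝒜) n rB c v).1 (outPair (P := P) (𝒜 := 𝒜) n rB c v).2 := by
  rw [outB_WB hW hB hc hv hrB]; rfl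

/-- **The run of the one-time forger in the one-time experiment**, against any signing oracle `Osig` whose answer to
`mH` is short: it asks `mH` iff the planted node is used, and outputs the component of the forged signature at the
planted level, of the emulation with the planted answer `Osig mH` (resp. `ε`). [Goldreich 2004, proof of Prop. 6.4.15,
Steps 3–4] [folklore] -/
theorem run_forgerB [Decidable (usedH P 𝒜 n (rOfB P 𝒜 n rB) (wOfB P 𝒜 n rB) (tOfB P 𝒜 n rB) c)] (Osig : Oracle)
    (hsig : usedH P 𝒜 n (rOfB P 𝒜 n rB) (wOfB P 𝒜 n rB) (tOfB P 𝒜 n rB) c → (Osig (mH P 𝒜 n (rOfB P 𝒜 n rB) (wOfB P 𝒜 n rB) (tOfB P 𝒜 n rB) c)).length ≤ B.PS.eval n) :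
    (forgerB P 𝒜 B.PcOf (B.cOf P 𝒜) (Bounds.ROf P 𝒜)).alg.run Osig 2 (xrB n (P.S.keyGen.run n c).1 rB) =
        some (if usedH P 𝒜 n (rOfB P 𝒜 n rB) (wOfB P 𝒜 n rB) (tOfB P 𝒜 n rB) c
          then outPair (P := P) (𝒜 := 𝒜) n rB c (Osig (mH P 𝒜 n (rOfB P 𝒜 n rB) (wOfB P 𝒜 n rB) (tOfB P 𝒜 n rB) c))
          else outPair (P := P) (𝒜 := 𝒜) n rB c []) ∧
      (forgerB P 𝒜 B.PcOf (B.cOf P 𝒜) (Bounds.ROf P 𝒜)).alg.queries Osig 2 (xrB n (P.S.keyGen.run n c).1 rB) =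
        (if usedH P 𝒜 n (rOfB P 𝒜 n rB) (wOfB P 𝒜 n rB) (tOfB P 𝒜 n rB) c then [mH P 𝒜 n (rOfB P 𝒜 n rB) (wOfB P 𝒜 n rB) (tOfB P 𝒜 n rB) c] else []) := by
  have hDi := DB_iff hW hB hc hrB
  by_cases hu : usedH P 𝒜 n (rOfB P 𝒜 n rB) (wOfB P 𝒜 n rB) (tOfB P 𝒜 n rB) c
  · have hD := hDi.2 hu
    rw [if_pos hu, if_pos hu, forgerB]
    refine ⟨?_, ?_⟩
    · rw [run_oneQueryPair_pos _ _ _ _ Osig hD 0, QB_eq hW hB hc hrB, Out1B]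
      have : boolPair (xrB n (P.S.keyGen.run n c).1 rB) (Osig (mH P 𝒜 n (rOfB P 𝒜 n rB) (wOfB P 𝒜 n rB) (tOfB P 𝒜 n rB) c)) =
          WB n (P.S.keyGen.run n c).1 rB (Osig (mH P 𝒜 n (rOfB P 𝒜 n rB) (wOfB P 𝒜 n rB) (tOfB P 𝒜 n rB) c)) := rfl
      rw [this, outB_WB' (hsig hu) hW hB hc hrB, fstF_boolPair, sndF_boolPair]
    · rw [queries_oneQueryPair_pos _ _ _ _ Osig hD 0, QB_eq hW hB hc hrB]
  · have hD' : DB P 𝒜 B.PcOf (B.cOf P 𝒜) (Bounds.ROf P 𝒜) (xrB n (P.S.keyGen.run n c).1 rB) ≠ [true] := fun h => hu (hDi.1 h)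
    rw [if_neg hu, if_neg hu, forgerB]
    refine ⟨?_, ?_⟩
    · rw [run_oneQueryPair_neg _ _ _ _ Osig hD' 1, Out0B, Function.comp_apply, w0F_xrB, outB_WB' (v := []) (by simp) hW hB hc hrB,
        fstF_boolPair, sndF_boolPair]
    · rw [queries_oneQueryPair_neg _ _ _ _ Osig hD' 1]

/-- The first step of the one-time forger: a query iff the planted node is used. [folklore] -/
theorem firstCoinLen_forgerB [Decidable (usedH P 𝒜 n (rOfB P 𝒜 n rB) (wOfB P 𝒜 n rB) (tOfB P 𝒜 n rB) c)] (sk : List Bool) :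
    P.S.firstCoinLen (forgerB P 𝒜 B.PcOf (B.cOf P 𝒜) (Bounds.ROf P 𝒜)) sk (xrB n (P.S.keyGen.run n c).1 rB) =
      if usedH P 𝒜 n (rOfB P 𝒜 n rB) (wOfB P 𝒜 n rB) (tOfB P 𝒜 n rB) c
      then P.S.sign.coinLen (pairCode (sk, mH P 𝒜 n (rOfB P 𝒜 n rB) (wOfB P 𝒜 n rB) (tOfB P 𝒜 n rB) c)).length else 0 := by
  have hDi := DB_iff hW hB hc hrB
  have hstep : (forgerB P 𝒜 B.PcOf (B.cOf P 𝒜) (Bounds.ROf P 𝒜)).alg.step (xrB n (P.S.keyGen.run n c).1 rB) [] =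
      if DB P 𝒜 B.PcOf (B.cOf P 𝒜) (Bounds.ROf P 𝒜) (xrB n (P.S.keyGen.run n c).1 rB) = [true]
      then Sum.inl (QB P 𝒜 B.PcOf (B.cOf P 𝒜) (Bounds.ROf P 𝒜) (xrB n (P.S.keyGen.run n c).1 rB))
      else Sum.inr (fstF (Out0B P 𝒜 B.PcOf (B.cOf P 𝒜) (Bounds.ROf P 𝒜) (xrB n (P.S.keyGen.run n c).1 rB)),
        sndF (Out0B P 𝒜 B.PcOf (B.cOf P 𝒜) (Bounds.ROf P 𝒜) (xrB n (P.S.keyGen.run n c).1 rB))) := by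
    simp only [forgerB, oneQueryPair, mapOut, oneQuery]
    split_ifs <;> rfl
  rw [SignatureScheme.firstCoinLen, hstep, QB_eq hW hB hc hrB]
  by_cases hu : usedH P 𝒜 n (rOfB P 𝒜 n rB) (wOfB P 𝒜 n rB) (tOfB P 𝒜 n rB) c
  · rw [if_pos (hDi.2 hu), if_pos hu]
  · rw [if_neg (fun h => hu (hDi.1 h)), if_neg hu]

omit hW hB hc hrB in
/-- **The hybrid slot event makes the one-time forger win.** For a valid slot, if the slot event of the hybrid attack
with the planted answer `v` holds (and the leaves are distinct), the output of the one-time forger is a valid one-time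
signature under the external key on a message it did not ask. [Goldreich 2004, proof of Prop. 6.4.15, Step 4]
[cite: Goldreich2004, Prop. 6.4.15] -/
theorem isForgery_of_GH (hrB : (cDPoly P 𝒜).eval n ≤ rB.length) {v : List Bool} [Decidable (usedH P 𝒜 n (rOfB P 𝒜 n rB) (wOfB P 𝒜 n rB) (tOfB P 𝒜 n rB) c)]
    (ht : tOfB P 𝒜 n rB < NSlot n (TA P 𝒜 n)) (hG : GH P 𝒜 n (rOfB P 𝒜 n rB) (wOfB P 𝒜 n rB) (tOfB P 𝒜 n rB) c v) :
    P.S.IsForgery (P.S.keyGen.run n c).1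
      (if usedH P 𝒜 n (rOfB P 𝒜 n rB) (wOfB P 𝒜 n rB) (tOfB P 𝒜 n rB) c then [mH P 𝒜 n (rOfB P 𝒜 n rB) (wOfB P 𝒜 n rB) (tOfB P 𝒜 n rB) c] else [])
      (some (outPair (P := P) (𝒜 := 𝒜) n rB c v)) := by
  classical
  set r := rOfB P 𝒜 n rB with hr
  set w := wOfB P 𝒜 n rB with hw
  set t := tOfB P 𝒜 n rB with htt
  set L := Lslot P 𝒜 n r t with hL
  set pkN := pkH P 𝒜 n r w t c with hpkN
  set ρ := ρD P 𝒜 n r with hρ'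
  have hrlen : r.length = (cDPoly P 𝒜).eval n := by rw [hr, rOfB, List.length_take, min_eq_left hrB]
  have hρ : TA P 𝒜 n * n ≤ ρ.length := by rw [hρ', ρD, List.length_drop, hrlen, cDPoly_eval]; omega
  have hlen : ∀ i < TA P 𝒜 n, (Yao.blk n i ρ).length = n := fun i hi =>
    Yao.length_blk_of_le (le_trans (Nat.mul_le_mul_right n (Nat.succ_le_of_lt hi)) hρ)
  have hLn : L.length ≤ n := length_labAt_le' (T := TA P 𝒜 n) _ ht
  have hpkL : pkN L = (P.S.keyGen.run n c).1 := by rw [hpkN, pkH, ← hL, Function.update_self]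
  obtain ⟨⟨α, sig, hout, htake, hver, hfresh⟩, hnc⟩ := hG
  rw [← hpkN, ← hL, ← hρ'] at hout hfresh
  rw [← hpkN, ← hL] at hver
  -- the output is the component at the planted level
  have houtPair : outPair (P := P) (𝒜 := 𝒜) n rB c v = compAt n α (sndF sig) L.length := by
    simp only [outPair, OvB, xH, ← hr, ← hw, ← htt, ← hL, ← hpkN, ← hρ']
    rw [hout]
    simp [ePair]
  refine ⟨_, _, by rw [houtPair], by rw [← hpkL]; exact hver, ?_⟩
  -- freshness: the only query is a message the planted node signed
  split_ifs with hu
  · rw [List.mem_singleton]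
    intro heq
    refine hfresh (mH P 𝒜 n r w t c) ?_ heq.symm
    have hU : firstUse n (TA P 𝒜 n) ρ L < (𝒜.alg.queriesIdx (OFunI n pkN (Function.update (sgNW P 𝒜 n r w) L fun _ => v) ρ) (TA P 𝒜 n) (xH P 𝒜 n r pkN)).length :=
      (used_iff (P := P) (𝒜 := 𝒜) pkN (sgNW P 𝒜 n r w) L ρ (fun _ => ([] : List Bool)) (fun _ => v) (xH P 𝒜 n r pkN)).1 hu
    have hUT : firstUse n (TA P 𝒜 n) ρ L < TA P 𝒜 n := lt_of_lt_of_le hU (OracleAlg.length_queriesIdx_le _ _ _ _)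
    rw [mH, mStar, ← hL, ← hpkN, ← hρ']
    rw [xH] at hU ⊢
    by_cases hlt : L.length < n
    · rw [if_pos hlt]
      exact Or.inl ⟨hlt, ⟨_, hU, take_blk_firstUse hUT⟩, rfl⟩
    · rw [if_neg hlt]
      have hLeq : L.length = n := le_antisymm hLn (not_lt.1 hlt)
      refine Or.inr ⟨_, hU, blk_firstUse hLeq hlen hUT, ?_⟩
      have hU0 : firstUse n (TA P 𝒜 n) ρ L < (𝒜.alg.queriesIdx (OFunI n pkN (Function.update (sgNW P 𝒜 n r w) L fun _ => []) ρ) (TA P 𝒜 n)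
          (boolPair (xA P n (pkN [])) (rA P 𝒜 n r))).length := hu
      rw [mStarLeaf, List.getD_eq_getElem _ _ hU0]
      exact getElem_firstUse_eq (P := P) (𝒜 := 𝒜) pkN (sgNW P 𝒜 n r w) L ρ (fun _ => []) (fun _ => v) _ hU0 hU
  · simp

end Experiment

end TreeSig

end Literature.Computability.Cryptography

/-! ## Part B. The one-time forger — its success probability

Topic `Literature/Computability/Cryptography`; the probability side of the one-time forger `forgerB` (Goldreich 2004,
proof of Prop. 6.4.15 / 6.4.17): in the one-time experiment of the underlying scheme `S` (`cmaExpPMF`, read through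
the exact one-query factorisation `cmaExp_toReal_eq_uniformAvg_of_le_one_exact`), its success probability dominates,
up to the factor `2^{-kS(n)}` lost in guessing the slot from `kS(n)` coins, the sum over the slots of the hybrid
averages of `TreeSigHybrid.lean`:

`∑_{t < NSlot} avg_r avg_w avg_c hybAvg n r w t c ≤ 2^{kS n} · oneTimeForgeProb S forgerB n`
(`sum_hybAvg_le_forgerB`), with `2^{kS n} ≤ 2 · NSlot n + 1` (`two_pow_kS_le`).
-/

namespace Literature.Computability.Cryptography

open _root_.Computability Complexity Complexity.Brick Polynomial Finset
open Complexity.OracleAlg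

namespace TreeSig

variable {P : Spec} {𝒜 : OracleAdversary (List Bool × List Bool)}

/-! ### The slot bits -/

/-- The number of slots is below `2^{kS}`. [folklore] -/
theorem NSlot_lt_two_pow_kS (n : ℕ) : NSlot n (TA P 𝒜 n) < 2 ^ kS P 𝒜 n := by
  rw [kS, ← qD_eval_NSlot]
  have := bitsToNat_lt (encodeNat ((qD P 𝒜).eval n))
  rwa [bitsToNat_encodeNat] at this

/-- `kS ≤ NSlot`. [folklore] -/
theorem kS_le (n : ℕ) : kS P 𝒜 n ≤ (qD P 𝒜).eval n := by
  rw [kS, TM2Pass.length_encodeNat_eq_size]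
  exact Nat.size_le.2 (Nat.lt_two_pow_self)

/-- `2^{kS} ≤ 2 · NSlot + 1` — the loss of guessing the slot is linear in the number of slots. [folklore] -/
theorem two_pow_kS_le (n : ℕ) : (2 : ℝ) ^ kS P 𝒜 n ≤ 2 * NSlot n (TA P 𝒜 n) + 1 := by
  rw [kS, TM2Pass.length_encodeNat_eq_size, qD_eval_NSlot]
  set N := NSlot n (TA P 𝒜 n)
  rcases Nat.eq_zero_or_pos N with h0 | hpos
  · rw [h0]; norm_num
  · have h1 : 2 ^ (Nat.size N - 1) ≤ N := Nat.lt_size.1 (by have := Nat.size_pos.2 hpos; omega)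
    have h2 : (2 : ℕ) ^ Nat.size N ≤ 2 * N := by
      have : Nat.size N = (Nat.size N - 1) + 1 := by have := Nat.size_pos.2 hpos; omega
      rw [this, pow_succ]; omega
    exact_mod_cast (show ((2 : ℕ) ^ Nat.size N : ℝ) ≤ 2 * N + 1 by exact_mod_cast h2.trans (Nat.le_succ _))

/-! ### Decoding the coins of a split string -/

section Decode

variable (n : ℕ) {r w tb rest : List Bool} (hr : r.length = (cDPoly P 𝒜).eval n) (hw : w.length = (mRPoly P 𝒜).eval n) (htb : tb.length = kS P 𝒜 n)

include hr in
/-- `rOfB_append` (bookkeeping). [folklore] -/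
theorem rOfB_append : rOfB P 𝒜 n (r ++ (w ++ (tb ++ rest))) = r := by rw [rOfB, List.take_left' hr]
include hr hw in
/-- `wOfB_append` (bookkeeping). [folklore] -/
theorem wOfB_append : wOfB P 𝒜 n (r ++ (w ++ (tb ++ rest))) = w := by rw [wOfB, List.drop_left' hr, List.take_left' hw]
include hr hw htb in
/-- `tbOfB_append` (bookkeeping). [folklore] -/
theorem tbOfB_append : tbOfB P 𝒜 n (r ++ (w ++ (tb ++ rest))) = tb := by
  rw [tbOfB, ← List.append_assoc, List.drop_left' (by simp [hr, hw]), List.take_left' htb]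
include hr hw htb in
/-- `tOfB_append` (bookkeeping). [folklore] -/
theorem tOfB_append : tOfB P 𝒜 n (r ++ (w ++ (tb ++ rest))) = min (bitsToNat tb) ((qD P 𝒜).eval n) := by rw [tOfB, tbOfB_append n hr hw htb]

end Decode

/-! ### The inner average dominates the hybrid average -/

open scoped Classical in
/-- The planted answer of the one-time forger: the external signature of `mH` with coins `ρe` if it asks, else `ε`. [folklore] -/
noncomputable def vStar (n : ℕ) (rB c ρe : List Bool) : List Bool :=
  if usedH P 𝒜 n (rOfB P 𝒜 n rB) (wOfB P 𝒜 n rB) (tOfB P 𝒜 n rB) c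
  then P.S.sign.run ((P.S.keyGen.run n c).2, mH P 𝒜 n (rOfB P 𝒜 n rB) (wOfB P 𝒜 n rB) (tOfB P 𝒜 n rB) c) ρe else []

/-- **The integrand of the one-time experiment dominates the hybrid average.** For key-generation coins `c` and coins
`r_B` of the one-time forger (long enough), the average over the signing coins of the exact length of the indicator of
the one-time forgery event is at least the hybrid average at the decoded slot (when valid).
[Goldreich 2004, proof of Prop. 6.4.15, Steps 2–4] [folklore] -/
theorem hybAvg_le_inner (hW : P.WF) {B : Bounds} (hB : B.OK P 𝒜) {n : ℕ} {c rB : List Bool} (hc : c.length = P.pG.eval n)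
    (hrB : (cDPoly P 𝒜).eval n ≤ rB.length) (ht : tOfB P 𝒜 n rB < NSlot n (TA P 𝒜 n))
    [DecidablePred (· ∈ P.S.oneTimeForgeEvent)] :
    hybAvg P 𝒜 n (rOfB P 𝒜 n rB) (wOfB P 𝒜 n rB) (tOfB P 𝒜 n rB) c ≤
      uniformAvg (P.S.firstCoinLen (forgerB P 𝒜 B.PcOf (B.cOf P 𝒜) (Bounds.ROf P 𝒜)) (P.S.keyGen.run n c).2 (xrB n (P.S.keyGen.run n c).1 rB)) fun ρe =>
        if ((P.S.keyGen.run n c).1,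
            (forgerB P 𝒜 B.PcOf (B.cOf P 𝒜) (Bounds.ROf P 𝒜)).alg.queries (P.S.sigOracleWith (P.S.keyGen.run n c).2 ρe) 2 (xrB n (P.S.keyGen.run n c).1 rB),
            (forgerB P 𝒜 B.PcOf (B.cOf P 𝒜) (Bounds.ROf P 𝒜)).alg.run (P.S.sigOracleWith (P.S.keyGen.run n c).2 ρe) 2 (xrB n (P.S.keyGen.run n c).1 rB)) ∈
            P.S.oneTimeForgeEvent then (1 : ℝ) else 0 := by
  classical
  have hks : P.S.keyGen.run n c ∈ (P.S.keyPMF n).support := SigOWF.FParams.mem_support_keyPMF P.S n c (by rw [hW.hcG]; exact hc)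
  -- pointwise: the event contains the hybrid slot event with the planted answer
  have hpt : ∀ ρe : List Bool,
      ρe.length = P.S.firstCoinLen (forgerB P 𝒜 B.PcOf (B.cOf P 𝒜) (Bounds.ROf P 𝒜)) (P.S.keyGen.run n c).2 (xrB n (P.S.keyGen.run n c).1 rB) →
      ind (GH P 𝒜 n (rOfB P 𝒜 n rB) (wOfB P 𝒜 n rB) (tOfB P 𝒜 n rB) c (vStar (P := P) (𝒜 := 𝒜) n rB c ρe)) ≤
        (if ((P.S.keyGen.run n c).1,
            (forgerB P 𝒜 B.PcOf (B.cOf P 𝒜) (Bounds.ROf P 𝒜)).alg.queries (P.S.sigOracleWith (P.S.keyGen.run n c).2 ρe) 2 (xrB n (P.S.keyGen.run n c).1 rB),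
            (forgerB P 𝒜 B.PcOf (B.cOf P 𝒜) (Bounds.ROf P 𝒜)).alg.run (P.S.sigOracleWith (P.S.keyGen.run n c).2 ρe) 2 (xrB n (P.S.keyGen.run n c).1 rB)) ∈
            P.S.oneTimeForgeEvent then (1 : ℝ) else 0) := by
    intro ρe hρe
    rw [firstCoinLen_forgerB hW hB hc hrB] at hρe
    have hsig : usedH P 𝒜 n (rOfB P 𝒜 n rB) (wOfB P 𝒜 n rB) (tOfB P 𝒜 n rB) c →
        (P.S.sigOracleWith (P.S.keyGen.run n c).2 ρe (mH P 𝒜 n (rOfB P 𝒜 n rB) (wOfB P 𝒜 n rB) (tOfB P 𝒜 n rB) c)).length ≤ B.PS.eval n := by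
      intro hu
      rw [if_pos hu] at hρe
      rw [SignatureScheme.sigOracleWith, List.take_of_length_le hρe.le]
      exact hB.hPS n _ hks _ _ hρe
    have hrun := run_forgerB hW hB hc hrB (P.S.sigOracleWith (P.S.keyGen.run n c).2 ρe) hsig
    have hv : vStar (P := P) (𝒜 := 𝒜) n rB c ρe = if usedH P 𝒜 n (rOfB P 𝒜 n rB) (wOfB P 𝒜 n rB) (tOfB P 𝒜 n rB) c
        then P.S.sigOracleWith (P.S.keyGen.run n c).2 ρe (mH P 𝒜 n (rOfB P 𝒜 n rB) (wOfB P 𝒜 n rB) (tOfB P 𝒜 n rB) c) else [] := by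
      rw [vStar]
      split_ifs with hu
      · rw [if_pos hu] at hρe
        rw [SignatureScheme.sigOracleWith, List.take_of_length_le hρe.le]
      · rfl
    by_cases hG : GH P 𝒜 n (rOfB P 𝒜 n rB) (wOfB P 𝒜 n rB) (tOfB P 𝒜 n rB) c (vStar (P := P) (𝒜 := 𝒜) n rB c ρe)
    · rw [ind_true hG, if_pos]
      rw [hrun.1, hrun.2]
      refine ⟨?_, by dsimp only; split_ifs <;> simp⟩
      have hF := isForgery_of_GH (c := c) hrB ht hG
      rw [hv] at hF
      dsimp only
      split_ifs at hF ⊢ with hu <;> exact hF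
    · rw [ind_false hG]; positivity
  -- average
  rw [hybAvg, firstCoinLen_forgerB hW hB hc hrB]
  split_ifs with hu
  · refine SigOWF.uniformAvg_mono fun ρe hρe => ?_
    have := hpt ρe (by rw [firstCoinLen_forgerB hW hB hc hrB, if_pos hu]; exact hρe)
    rwa [vStar, if_pos hu] at this
  · have huniv : (Finset.univ : Finset (List.Vector Bool 0)) = {List.Vector.nil} :=
      Finset.eq_singleton_iff_unique_mem.2 ⟨Finset.mem_univ _, fun v _ => v.eq_nil⟩
    rw [uniformAvg, huniv, Finset.sum_singleton, pow_zero, div_one, List.Vector.toList_nil]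
    have := hpt [] (by rw [firstCoinLen_forgerB hW hB hc hrB, if_neg hu]; rfl)
    rwa [vStar, if_neg hu] at this

/-! ### Summing over the slots: the success probability of the one-time forger -/

/-- Scalars come out of uniform averages. [folklore] -/
theorem uniformAvg_const_mul (m : ℕ) (a : ℝ) (f : List Bool → ℝ) : uniformAvg m (fun x => a * f x) = a * uniformAvg m f := by
  unfold uniformAvg
  rw [← Finset.mul_sum, mul_div_assoc]

/-- The hybrid average is nonnegative. [folklore] -/
theorem hybAvg_nonneg (n : ℕ) (r w : List Bool) (t : ℕ) (c : List Bool) : 0 ≤ hybAvg P 𝒜 n r w t c := by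
  classical
  rw [hybAvg]
  split_ifs
  · exact uniformAvg_nonneg fun _ => ind_nonneg _
  · exact ind_nonneg _

/-- **Guessing the slot**: averaging over the `kS` slot bits a nonnegative function of the decoded slot recovers at
least `2^{-kS}` of the sum over the valid slots. [Goldreich 2004, proof of Prop. 6.4.15, Step 1] [folklore] -/
theorem sum_le_two_pow_mul_uniformAvg_slot (n : ℕ) (f : ℕ → ℝ) (hf : ∀ t, 0 ≤ f t) :
    ∑ t ∈ Finset.range (NSlot n (TA P 𝒜 n)), f t ≤
      (2 : ℝ) ^ kS P 𝒜 n * uniformAvg (kS P 𝒜 n) fun tb =>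
        if min (bitsToNat tb) ((qD P 𝒜).eval n) < NSlot n (TA P 𝒜 n) then f (min (bitsToNat tb) ((qD P 𝒜).eval n)) else 0 := by
  classical
  set k := kS P 𝒜 n with hk
  set N := NSlot n (TA P 𝒜 n) with hN
  have hNk : N < 2 ^ k := NSlot_lt_two_pow_kS n
  have hqD : (qD P 𝒜).eval n = N := qD_eval_NSlot P 𝒜 n
  rw [hqD, uniformAvg, mul_div_cancel₀ _ (by positivity)]
  -- the valid slots inject into the slot bit patterns
  set φ : ℕ → List.Vector Bool k := fun t => ⟨Complexity.natBits k t, Complexity.length_natBits k t⟩ with hφ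
  have hinj : Set.InjOn φ (Finset.range N : Set ℕ) := by
    intro a ha b hb h
    have ha' : a < 2 ^ k := lt_trans (Finset.mem_coe.1 ha |> Finset.mem_range.1) hNk
    have hb' : b < 2 ^ k := lt_trans (Finset.mem_coe.1 hb |> Finset.mem_range.1) hNk
    have := congrArg (fun v : List.Vector Bool k => bitsToNat v.toList) h
    simp only [hφ, List.Vector.toList_mk, Complexity.bitsToNat_natBits ha', Complexity.bitsToNat_natBits hb'] at this
    exact this
  have hval : ∀ t ∈ Finset.range N, (if min (bitsToNat (φ t).toList) N < N then f (min (bitsToNat (φ t).toList) N) else 0) = f t := by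
    intro t ht
    have ht' := Finset.mem_range.1 ht
    have : bitsToNat (φ t).toList = t := by simp only [hφ, List.Vector.toList_mk]; exact Complexity.bitsToNat_natBits (lt_trans ht' hNk)
    rw [this, min_eq_left ht'.le, if_pos ht']
  calc ∑ t ∈ Finset.range N, f t
      = ∑ t ∈ Finset.range N, (if min (bitsToNat (φ t).toList) N < N then f (min (bitsToNat (φ t).toList) N) else 0) :=
        Finset.sum_congr rfl fun t ht => (hval t ht).symm
    _ = ∑ v ∈ (Finset.range N).image φ, (if min (bitsToNat v.toList) N < N then f (min (bitsToNat v.toList) N) else 0) :=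
        (Finset.sum_image (f := fun v : List.Vector Bool k => if min (bitsToNat v.toList) N < N then f (min (bitsToNat v.toList) N) else 0) hinj).symm
    _ ≤ ∑ v : List.Vector Bool k, (if min (bitsToNat v.toList) N < N then f (min (bitsToNat v.toList) N) else 0) :=
        Finset.sum_le_sum_of_subset_of_nonneg (Finset.subset_univ _) fun v _ _ => by split_ifs <;> simp [hf]

/-- **The success probability of the one-time forger dominates the hybrid averages.**
`∑_{t < NSlot} avg_r avg_w avg_c hybAvg n r w t c ≤ 2^{kS n} · oneTimeForgeProb S forgerB n`.
[Goldreich 2004, proof of Prop. 6.4.15 (Steps 1–4: "with probability at least `1/((2n+1)t)` … `A` succeeds"); Prop. 6.4.17]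
[cite: Goldreich2004, Prop. 6.4.15] -/
theorem sum_hybAvg_le_forgerB (hW : P.WF) {B : Bounds} (hB : B.OK P 𝒜) (n : ℕ) :
    ∑ t ∈ Finset.range (NSlot n (TA P 𝒜 n)), uniformAvg ((cDPoly P 𝒜).eval n) (fun r =>
      uniformAvg ((fuelD P 𝒜).eval n * P.R.eval n) fun w => uniformAvg (P.pG.eval n) fun c => hybAvg P 𝒜 n r w t c) ≤
      (2 : ℝ) ^ kS P 𝒜 n * oneTimeForgeProb P.S (forgerB P 𝒜 B.PcOf (B.cOf P 𝒜) (Bounds.ROf P 𝒜)) n := by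
  classical
  set Bf := forgerB P 𝒜 B.PcOf (B.cOf P 𝒜) (Bounds.ROf P 𝒜) with hBf
  set N := NSlot n (TA P 𝒜 n) with hN
  set cD := (cDPoly P 𝒜).eval n with hcD
  set mR := (mRPoly P 𝒜).eval n with hmR
  set k := kS P 𝒜 n with hk
  have hmR' : (fuelD P 𝒜).eval n * P.R.eval n = mR := by rw [hmR, mRPoly, eval_mul]
  rw [hmR']
  -- the one-time experiment as a triple average (exact form)
  have hE : ∀ t ∈ P.S.oneTimeForgeEvent, t.2.1.length ≤ 1 := fun t ht => ht.2
  have hotf := P.S.cmaExp_toReal_eq_uniformAvg_of_le_one_exact Bf n P.S.oneTimeForgeEvent hE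
  have hnlen : (unaryEncodeNat n).length = n := by rw [Complexity.unaryEncodeNat_eq_replicate, List.length_replicate]
  rw [oneTimeForgeProb, hotf, hnlen, hW.hcG]
  -- Step A–C for fixed key coins `c`
  have hinner : ∀ c : List Bool, c.length = P.pG.eval n →
      ∑ t ∈ Finset.range N, uniformAvg cD (fun r => uniformAvg mR fun w => hybAvg P 𝒜 n r w t c) ≤
        (2 : ℝ) ^ k * uniformAvg (Bf.coins.eval (boolPair (unaryEncodeNat n) (P.S.keyGen.run n c).1).length) (fun rB =>
          uniformAvg (P.S.firstCoinLen Bf (P.S.keyGen.run n c).2 (boolPair (boolPair (unaryEncodeNat n) (P.S.keyGen.run n c).1) rB)) fun ρe =>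
            if ((P.S.keyGen.run n c).1,
                Bf.alg.queries (P.S.sigOracleWith (P.S.keyGen.run n c).2 ρe) (Bf.fuel.eval (boolPair (unaryEncodeNat n) (P.S.keyGen.run n c).1).length)
                  (boolPair (boolPair (unaryEncodeNat n) (P.S.keyGen.run n c).1) rB),
                Bf.alg.run (P.S.sigOracleWith (P.S.keyGen.run n c).2 ρe) (Bf.fuel.eval (boolPair (unaryEncodeNat n) (P.S.keyGen.run n c).1).length)
                  (boolPair (boolPair (unaryEncodeNat n) (P.S.keyGen.run n c).1) rB)) ∈ P.S.oneTimeForgeEvent then (1 : ℝ) else 0) := by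
    intro c hc
    have hfuel : Bf.fuel.eval (boolPair (unaryEncodeNat n) (P.S.keyGen.run n c).1).length = 2 := by
      rw [hBf, forgerB]; exact eval_ofNat 2 _
    rw [hfuel]
    have hconv : uniformAvg cD (fun r => uniformAvg mR fun w => ∑ t ∈ Finset.range N, hybAvg P 𝒜 n r w t c) =
        ∑ t ∈ Finset.range N, uniformAvg cD (fun r => uniformAvg mR fun w => hybAvg P 𝒜 n r w t c) := by
      simp_rw [uniformAvg_finset_sum]
    rw [← hconv]
    -- the coin string of the forger splits as `r ‖ w ‖ tb ‖ rest`
    set ℓ := (boolPair (unaryEncodeNat n) (P.S.keyGen.run n c).1).length with hℓ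
    have hnℓ : n ≤ ℓ := by rw [hℓ, length_boolPair, hnlen]; omega
    have hCB : Bf.coins.eval ℓ = cD + (mR + (k + (Bf.coins.eval ℓ - (cD + mR + k)))) := by
      have h1 : cD + mR + k ≤ Bf.coins.eval ℓ := by
        have hmono := TM2Iter.eval_mono (cBPoly P 𝒜) hnℓ
        have h2 : (cBPoly P 𝒜).eval n = cD + mR + (qD P 𝒜).eval n := by rw [cBPoly, eval_add, eval_add]
        have h3 := kS_le (P := P) (𝒜 := 𝒜) n
        rw [hBf, forgerB]
        change cD + mR + k ≤ (cBPoly P 𝒜).eval ℓ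
        omega
      omega
    rw [hCB, uniformAvg_append', ← uniformAvg_const_mul]
    refine SigOWF.uniformAvg_mono fun r hr => ?_
    rw [uniformAvg_append', ← uniformAvg_const_mul]
    refine SigOWF.uniformAvg_mono fun w hw => ?_
    rw [uniformAvg_append']
    -- Step C: guessing the slot, then Step A pointwise in `tb` (and `rest`)
    refine (sum_le_two_pow_mul_uniformAvg_slot n (fun t => hybAvg P 𝒜 n r w t c) fun t => hybAvg_nonneg n r w t c).trans ?_
    refine mul_le_mul_of_nonneg_left (SigOWF.uniformAvg_mono fun tb htb => ?_) (by positivity)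
    rw [← SigOWF.uniformAvg_const' (Bf.coins.eval ℓ - (cD + mR + k))
      (if min (bitsToNat tb) ((qD P 𝒜).eval n) < NSlot n (TA P 𝒜 n) then hybAvg P 𝒜 n r w (min (bitsToNat tb) ((qD P 𝒜).eval n)) c else 0)]
    refine SigOWF.uniformAvg_mono fun rest _ => ?_
    have hrB : cD ≤ (r ++ (w ++ (tb ++ rest))).length := by simp [hr]
    have hdr := rOfB_append (P := P) (𝒜 := 𝒜) n (rest := rest) (w := w) (tb := tb) hr
    have hdw := wOfB_append (P := P) (𝒜 := 𝒜) n (rest := rest) (tb := tb) hr hw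
    have hdt := tOfB_append (P := P) (𝒜 := 𝒜) n (rest := rest) hr hw htb
    split_ifs with hvalid
    · have h := hybAvg_le_inner hW hB hc hrB (by rw [hdt]; exact hvalid)
      rw [hdr, hdw, hdt] at h
      exact h
    · exact uniformAvg_nonneg fun _ => by positivity
  -- Step D: assemble over `c`
  have hswap : ∀ t, uniformAvg cD (fun r => uniformAvg mR fun w => uniformAvg (P.pG.eval n) fun c => hybAvg P 𝒜 n r w t c) =
      uniformAvg (P.pG.eval n) fun c => uniformAvg cD fun r => uniformAvg mR fun w => hybAvg P 𝒜 n r w t c := by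
    intro t
    simp_rw [uniformAvg_comm' mR (P.pG.eval n)]
    rw [uniformAvg_comm' cD (P.pG.eval n)]
  rw [Finset.sum_congr rfl fun t _ => hswap t, ← uniformAvg_finset_sum, ← uniformAvg_const_mul]
  refine SigOWF.uniformAvg_mono fun c hc => ?_
  exact hinner c hc

end TreeSig

end Literature.Computability.Cryptography

/-! ## Part C. Security (Goldreich 2004, Prop. 6.4.17 / Theorem 6.4.9)

Topic `Literature/Computability/Cryptography`; the assembly of the security proof of the random-leaf authentication-tree
scheme `TreeSig.scheme P` over a one-time signature scheme `S` and a pseudorandom function ensemble `F`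
(Construction 6.4.16): for every PPT forger `𝒜`,

`forgeProb (scheme P) 𝒜 n ≤ prfAdvantage F κ (·+1) R D n + TA(n)²/2ⁿ + (2 NSlot(n) + 1) · oneTimeForgeProb S B n`

(`forgeProb_le`) with the PPT distinguisher `D` of `TreeSigDistinguisher.lean` and the PPT one-time forger `B` of
`TreeSigForgerB.lean`; hence (`isEUFCMA`) the tree scheme is EUF-CMA secure whenever `F` is a PRF at the lengths used,
`S` is one-time secure with signatures of bounded length whose signer reads boundedly many coins, and the bookkeeping
hypotheses `WF` hold.
-/

namespace Literature.Computability.Cryptography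

open _root_.Computability Complexity Complexity.Brick Polynomial Finset Filter Asymptotics
open Complexity.OracleAlg

namespace TreeSig

variable {P : Spec} {𝒜 : OracleAdversary (List Bool × List Bool)}

/-! ### The forging bound -/

/-- **The forging bound of the authentication-tree scheme.** [Goldreich 2004, proofs of Prop. 6.4.15 / 6.4.17]
[cite: Goldreich2004, Prop. 6.4.17] -/
theorem forgeProb_le (hcs : P.HCS) (hW : P.WF) {B : Bounds} (hB : B.OK P 𝒜) (n : ℕ) :
    forgeProb (scheme P) 𝒜 n ≤
      prfAdvantage P.F P.κ (fun m => m + 1) (fun m => P.R.eval m) (distinguisher P 𝒜 B.PcOf (B.cOf P 𝒜) (Bounds.ROf P 𝒜)) n +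
        (TA P 𝒜 n : ℝ) ^ 2 / 2 ^ n +
        (2 * NSlot n (TA P 𝒜 n) + 1) * oneTimeForgeProb P.S (forgerB P 𝒜 B.PcOf (B.cOf P 𝒜) (Bounds.ROf P 𝒜)) n := by
  have h1 := prfRealProb_distinguisher hW hB n
  have h2 := prfIdealProb_le_hybrid hcs hW hB n
  have h3 := sum_hybAvg_le_forgerB hW hB n
  have h4 := two_pow_kS_le (P := P) (𝒜 := 𝒜) n
  have h0 : 0 ≤ oneTimeForgeProb P.S (forgerB P 𝒜 B.PcOf (B.cOf P 𝒜) (Bounds.ROf P 𝒜)) n := oneTimeForgeProb_nonneg _ _ _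
  have hadv : prfRealProb P.F P.κ (fun m => m + 1) (distinguisher P 𝒜 B.PcOf (B.cOf P 𝒜) (Bounds.ROf P 𝒜)) n -
      prfIdealProb (fun m => m + 1) (fun m => P.R.eval m) (distinguisher P 𝒜 B.PcOf (B.cOf P 𝒜) (Bounds.ROf P 𝒜)) n ≤
      prfAdvantage P.F P.κ (fun m => m + 1) (fun m => P.R.eval m) (distinguisher P 𝒜 B.PcOf (B.cOf P 𝒜) (Bounds.ROf P 𝒜)) n :=
    le_abs_self _
  rw [← h1]
  nlinarith [mul_le_mul_of_nonneg_right h4 h0]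

/-! ### Negligibility -/

/-- `p(n)²/2ⁿ` is negligible (local copy of `superpolynomialDecay_natPoly_sq_div_two_pow` of `PRPSwitchingLemma.lean`,
not imported here). [folklore] -/
theorem superpolynomialDecay_natPoly_sq_div_two_pow' (p : Polynomial ℕ) :
    SuperpolynomialDecay atTop (fun n : ℕ => (n : ℝ)) (fun n => ((p.eval n : ℕ) : ℝ) ^ 2 / 2 ^ n) := by
  have h0 : SuperpolynomialDecay atTop (fun n : ℕ => (n : ℝ)) (fun n => ((1 : ℝ) / 2) ^ n) := by
    intro m
    exact tendsto_pow_const_mul_const_pow_of_abs_lt_one m (r := (1 : ℝ) / 2) (by rw [abs_of_pos (by norm_num)]; norm_num)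
  have h1 := h0.polynomial_mul ((p * p).map (Nat.castRingHom ℝ))
  refine h1.congr fun n => ?_
  rw [Polynomial.eval_map, Polynomial.eval₂_at_natCast, Polynomial.eval_mul, map_mul, one_div_pow]
  simp only [eq_natCast, Nat.cast_id]
  ring

/-- A natural polynomial factor preserves negligibility. [Goldreich 2001, §1.3.5] [folklore] -/
theorem superpolynomialDecay_natPoly_mul {v : ℕ → ℝ} (q : Polynomial ℕ) (hv : SuperpolynomialDecay atTop (fun n : ℕ => (n : ℝ)) v) :
    SuperpolynomialDecay atTop (fun n : ℕ => (n : ℝ)) (fun n => ((q.eval n : ℕ) : ℝ) * v n) := by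
  refine (hv.polynomial_mul (q.map (Nat.castRingHom ℝ))).congr fun n => ?_
  rw [Polynomial.eval_map, Polynomial.eval₂_at_natCast]
  simp only [eq_natCast, Nat.cast_id]

/-! ### Security -/

/-- **Security of the authentication-tree scheme (Goldreich 2004, Prop. 6.4.17 with Prop. 6.4.15).** If the function
ensemble `F` is pseudorandom at the lengths used (`(n+1)`-bit inputs, `R(n)`-bit outputs), the one-time scheme `S` is
one-time secure with signatures of bounded length (`SigBound`) and a signer reading at most `CS(n)` coins (`HCS`), and
the bookkeeping `WF` holds, then the tree scheme is EUF-CMA secure. [cite: Goldreich2004, Prop. 6.4.17] -/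
theorem isEUFCMA (hW : P.WF) (hcs : P.HCS) (hPRF : IsPRF P.F P.κ (fun m => m + 1) fun m => P.R.eval m)
    (hOTS : P.S.IsOneTimeSecure) (hSB : ∃ PS : Polynomial ℕ, SigBound P.S PS) : (scheme P).IsEUFCMA := by
  refine ⟨isEfficient_of_isEfficientFamily P hOTS.1 hPRF.1, isCorrect hW, fun 𝒜 h𝒜 => ?_⟩
  obtain ⟨PS, hPS⟩ := hSB
  have hK : P.S.keyGen.IsPolyTime unaryEncodeNat pairCode := hOTS.1.1
  have hSg : P.S.sign.IsPolyTime pairCode id := hOTS.1.2.1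
  obtain ⟨Bd, hBd⟩ := exists_bounds hK hPS h𝒜
  set D := distinguisher P 𝒜 Bd.PcOf (Bd.cOf P 𝒜) (Bounds.ROf P 𝒜) with hD
  set Bf := forgerB P 𝒜 Bd.PcOf (Bd.cOf P 𝒜) (Bounds.ROf P 𝒜) with hBf
  have hDppt : D.IsPPT encodingBoolBool := isPPT_distinguisher P 𝒜 h𝒜 hOTS.1 _ _ _
  have hBppt : Bf.IsPPT ((encodingList Bool).pairBool (encodingList Bool)) := isPPT_forgerB P 𝒜 h𝒜 hK hSg _ _ _
  have hnegD := hPRF.2 D hDppt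
  have hnegB := hOTS.2.2 Bf hBppt
  have hnegC : SuperpolynomialDecay atTop (fun n : ℕ => (n : ℝ)) (fun n => (TA P 𝒜 n : ℝ) ^ 2 / 2 ^ n) := by
    refine (superpolynomialDecay_natPoly_sq_div_two_pow' (TAPoly P 𝒜)).congr fun n => ?_
    rw [TA_eq]
  have hnegS : SuperpolynomialDecay atTop (fun n : ℕ => (n : ℝ)) (fun n => (2 * NSlot n (TA P 𝒜 n) + 1 : ℝ) * oneTimeForgeProb P.S Bf n) := by
    refine (superpolynomialDecay_natPoly_mul (2 * qD P 𝒜 + 1) hnegB).congr fun n => ?_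
    rw [eval_add, eval_mul, eval_ofNat, eval_one, qD_eval_NSlot]
    push_cast
    ring
  have hsum := hnegD.add (hnegC.add hnegS)
  refine SigOWF.superpolynomialDecay_of_dominated (g := id) X hsum (fun N => forgeProb_nonneg _ _ _)
    (Eventually.of_forall fun N => ?_) tendsto_id (Eventually.of_forall fun N => by simp)
  have h := forgeProb_le hcs hW hBd N
  simp only [id, Pi.add_apply]
  linarith

end TreeSig

end Literature.Computability.Cryptography

/-! ## Part D. Secure signature schemes from one-time schemes and pseudorandom functions

Topic `Literature/Computability/Cryptography`; the existence form of Goldreich's Theorem 6.4.9 (via Prop. 6.4.17 and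
Construction 6.4.16): **if a one-time secure signature scheme (with the stated bookkeeping: polynomial coin budgets,
short verification keys, signatures of bounded length, a signer reading boundedly many coins) exists and pseudorandom
functions exist, then EUF-CMA secure signature schemes exist** (`secureSignaturesExist_of_isOneTimeSecure_of_PRFExist`).
The pseudorandom function at the lengths the tree needs (`n + 1`-bit inputs, `pG(n) + CS(n)`-bit outputs) is obtained
from a length-preserving one by `PseudorandomFunctionsGeneralized.lean` (Goldreich 2001, §3.6.4).
-/

namespace Literature.Computability.Cryptography

open _root_.Computability Complexity Complexity.Brick Polynomial

namespace TreeSig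

/-- **Secure signature schemes from a one-time scheme and pseudorandom functions** (Goldreich 2004, Thm. 6.4.9 via
Construction 6.4.16 / Prop. 6.4.17). The hypotheses on the one-time scheme `S`: one-time security; coin budgets `pG` of
the key generator and `pS` of the signer; verification keys of length `≤ PK(n)`; the signer reads at most the first
`CS(n)` of its coins under keys of `G(1ⁿ)`; signatures of length `≤ PS(n)`.
[cite: Goldreich2004, Theorem 6.4.9] -/
theorem secureSignaturesExist_of_isOneTimeSecure_of_PRFExist (S : SignatureScheme) (pG pS CS PK PS : Polynomial ℕ)
    (hOTS : S.IsOneTimeSecure)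
    (hcG : ∀ n, S.keyGen.coinLen n = pG.eval n) (hcS : ∀ ℓ, S.sign.coinLen ℓ = pS.eval ℓ)
    (hPK : ∀ (n : ℕ) (c : List Bool), c.length = pG.eval n → (S.keyGen.run n c).1.length ≤ PK.eval n)
    (hCS : ∀ (n : ℕ) (c : List Bool), c.length = pG.eval n → ∀ (m ρ : List Bool),
      ρ.length = S.sign.coinLen (pairCode ((S.keyGen.run n c).2, m)).length →
      S.sign.run ((S.keyGen.run n c).2, m) ρ = S.sign.run ((S.keyGen.run n c).2, m) (fitLen (ρ.take (CS.eval n)) ρ.length))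
    (hSB : SigBound S PS) (hPRF : PRFExist) : SecureSignaturesExist := by
  obtain ⟨F, κ, hF⟩ := GenPRF.exists_isPRF_of_PRFExist_of_eq hPRF (ℓin := fun n => n + 1) (ℓout := fun n => (pG + CS).eval n)
    (X + 1) (pG + CS) (fun n => by simp) (fun n => rfl)
  let P : Spec := ⟨S, F, κ, pG, pS, CS, PK⟩
  have hW : P.WF := ⟨hcG, hcS, hPK, fun n k x hk hx => hF.1.2.2 n k x hk hx, hOTS.2.1⟩
  have hcs : P.HCS := hCS
  exact ⟨scheme P, isEUFCMA hW hcs hF hOTS ⟨PS, hSB⟩⟩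

end TreeSig

end Literature.Computability.Cryptography
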